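import Summits.Ventures.DiscreteObjects.Hadamard.HadamardParity668
import Summits.Ventures.DiscreteObjects.Hadamard.PrimeOrderDiscrete

/-!
# Hadamard 668 census, family F12 — H(668)-level orbit counts for signed automorphisms of order 3, 5, 7, 11 (kernel)

Framing: lottery ticket; floor = certified bounds/negative ranges.

Cell pub-namedobj (venture DiscreteObjects), target (H), hadamard gen 8.  Transfer of the kernel orbit-number theorems
`orbitCount_3'`, `orbitCount_5'`, `orbitCount_7'` (`PrimeOrderDiscrete`) and `orbitCount_11` (`PrimeOrderSmallParity`) from the
2-(667,333,166) structure to a Hadamard matrix `H` of order `668` with a NONTRIVIAL signed-permutation automorphism `(π, κ, d, e)`,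
`π^p = κ^p = 1`: the number `m` of `κ`-orbits of length `p` on columns satisfies
`p = 3: 168 ≤ m ≤ 222`, `p = 5: 112 ≤ m ≤ 132`, `p = 7: 84 ≤ m ≤ 94`, `p = 11: 56 ≤ m ≤ 60`, and `m` is even
(**`hadamard668_signedAut_colClasses_window`**; rows by the transpose, **`hadamard668_signedAut_rowClasses_window`**).  Route as in
`HadamardParity668`: fixed row and column (`p ∤ 668`), `π ≠ 1` (`signedAut_snd_eq_one`), `transfer668`, and the classes of `κ` are
those of its restriction to `{j ≠ c}`.  With `HadamardParity668`, `PrimeOrderSummary668B`, `AutomorphismFixedRows668`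
(`p = 37, 41, 83`) and `FixedSubmatrix41`/`FixedSubmatrixOrth` this is the H(668) form of census line (4).  Ours; no `sorry`.
-/

open Finset BigOperators Matrix

namespace Summit.Ventures.DiscreteObjects.Hadamard

open Literature.Combinatorics.Designs.GoethalsSeidel (IsHadamardMatrix)

variable {ι : Type*} [Fintype ι] [DecidableEq ι]

/-- **Column-orbit windows.**  For a Hadamard matrix of order `668` with a nontrivial signed automorphism `(π, κ, d, e)`,
`π^p = κ^p = 1`, `p ∈ {3, 5, 7, 11}`: the number of `κ`-orbits of length `p` is even and lies in the census window. -/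
theorem hadamard668_signedAut_colClasses_window {H : Matrix ι ι ℤ} (hH : IsHadamardMatrix H) (hι : Fintype.card ι = 668)
    {p : ℕ} (hmem : p = 3 ∨ p = 5 ∨ p = 7 ∨ p = 11)
    (π κ : Equiv.Perm ι) (d e : ι → ℤ) (haut : IsSignedAut H π κ d e) (hπ : π ^ p = 1) (hκ : κ ^ p = 1)
    (hne : π ≠ 1 ∨ κ ≠ 1) :
    2 ∣ (blockClasses κ p).card ∧
    (p = 3 → 168 ≤ (blockClasses κ p).card ∧ (blockClasses κ p).card ≤ 222) ∧
    (p = 5 → 112 ≤ (blockClasses κ p).card ∧ (blockClasses κ p).card ≤ 132) ∧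
    (p = 7 → 84 ≤ (blockClasses κ p).card ∧ (blockClasses κ p).card ≤ 94) ∧
    (p = 11 → 56 ≤ (blockClasses κ p).card ∧ (blockClasses κ p).card ≤ 60) := by
  have hp : p.Prime := by rcases hmem with rfl | rfl | rfl | rfl <;> norm_num
  have hodd : Odd p := by rcases hmem with rfl | rfl | rfl | rfl <;> decide
  have hpd : ¬ p ∣ 668 := by rcases hmem with rfl | rfl | rfl | rfl <;> norm_num
  have hcard : (Fintype.card ι : ℤ) ≠ 0 := by rw [hι]; norm_num
  have hπ1 : π ≠ 1 := by
    rcases hne with h | h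
    · exact h
    · intro hπ1
      apply h
      rw [hπ1] at haut
      exact signedAut_snd_eq_one H hH hcard haut hodd hκ
  have hnd : ¬ p ∣ Fintype.card ι := by rw [hι]; exact hpd
  haveI : Fact p.Prime := ⟨hp⟩
  obtain ⟨r, hr⟩ := Equiv.Perm.exists_fixed_point_of_prime (n := 1) hnd (σ := π) (by rw [pow_one]; exact hπ)
  obtain ⟨c, hc⟩ := Equiv.Perm.exists_fixed_point_of_prime (n := 1) hnd (σ := κ) (by rw [pow_one]; exact hκ)
  obtain ⟨hπr, hκc, h01, hrow, hpair, hcol, hcpair, -, hB, hN, hρ, hτ, ⟨x₀, hx₀⟩⟩ :=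
    transfer668 hH hι p π κ d e haut hπ hκ hπ1 hr hc
  -- classes of the restriction of κ to {j ≠ c} are the classes of κ
  have e1 := card_fixed_add_classes (κ.subtypePerm hκc : Equiv.Perm {j // j ≠ c}) hp hτ
  have e2 := card_fixed_add_classes κ hp hκ
  have e3 := card_fixed_eq_succ κ c hc hκc
  rw [hB] at e1
  rw [hι] at e2
  have e4 : (blockClasses (κ.subtypePerm hκc : Equiv.Perm {j // j ≠ c}) p).card * p = (blockClasses κ p).card * p := by
    omega
  have ecl := Nat.eq_of_mul_eq_mul_right hp.pos e4
  rcases hmem with rfl | rfl | rfl | rfl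
  · obtain ⟨hlo, hhi, h2⟩ := orbitCount_3' (fun (x : {i // i ≠ r}) (y : {j // j ≠ c}) => inc H r c x.1 y.1) h01 hrow hpair hcol hcpair hB (π.subtypePerm hπr : Equiv.Perm {i // i ≠ r})
      (κ.subtypePerm hκc : Equiv.Perm {j // j ≠ c}) hN hρ hτ x₀ hx₀
    rw [ecl] at hlo hhi h2
    exact ⟨h2, fun _ => ⟨hlo, hhi⟩, fun h => by omega, fun h => by omega, fun h => by omega⟩
  · obtain ⟨hlo, hhi, h2⟩ := orbitCount_5' (fun (x : {i // i ≠ r}) (y : {j // j ≠ c}) => inc H r c x.1 y.1) h01 hrow hpair hcol hcpair hB (π.subtypePerm hπr : Equiv.Perm {i // i ≠ r})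
      (κ.subtypePerm hκc : Equiv.Perm {j // j ≠ c}) hN hρ hτ x₀ hx₀
    rw [ecl] at hlo hhi h2
    exact ⟨h2, fun h => by omega, fun _ => ⟨hlo, hhi⟩, fun h => by omega, fun h => by omega⟩
  · obtain ⟨hlo, hhi, h2⟩ := orbitCount_7' (fun (x : {i // i ≠ r}) (y : {j // j ≠ c}) => inc H r c x.1 y.1) h01 hrow hpair hcol hcpair hB (π.subtypePerm hπr : Equiv.Perm {i // i ≠ r})
      (κ.subtypePerm hκc : Equiv.Perm {j // j ≠ c}) hN hρ hτ x₀ hx₀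
    rw [ecl] at hlo hhi h2
    exact ⟨h2, fun h => by omega, fun h => by omega, fun _ => ⟨hlo, hhi⟩, fun h => by omega⟩
  · have h11 := orbitCount_11 (fun (x : {i // i ≠ r}) (y : {j // j ≠ c}) => inc H r c x.1 y.1) h01 hrow hpair hcol hcpair hB (π.subtypePerm hπr : Equiv.Perm {i // i ≠ r})
      (κ.subtypePerm hκc : Equiv.Perm {j // j ≠ c}) hN hρ hτ x₀ hx₀
    rw [ecl] at h11
    refine ⟨by omega, fun h => by omega, fun h => by omega, fun h => by omega, fun _ => by omega⟩

/-- **Row-orbit windows** (the same for `π`, via the transpose). -/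
theorem hadamard668_signedAut_rowClasses_window {H : Matrix ι ι ℤ} (hH : IsHadamardMatrix H) (hι : Fintype.card ι = 668)
    {p : ℕ} (hmem : p = 3 ∨ p = 5 ∨ p = 7 ∨ p = 11)
    (π κ : Equiv.Perm ι) (d e : ι → ℤ) (haut : IsSignedAut H π κ d e) (hπ : π ^ p = 1) (hκ : κ ^ p = 1)
    (hne : π ≠ 1 ∨ κ ≠ 1) :
    2 ∣ (blockClasses π p).card ∧
    (p = 3 → 168 ≤ (blockClasses π p).card ∧ (blockClasses π p).card ≤ 222) ∧
    (p = 5 → 112 ≤ (blockClasses π p).card ∧ (blockClasses π p).card ≤ 132) ∧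
    (p = 7 → 84 ≤ (blockClasses π p).card ∧ (blockClasses π p).card ≤ 94) ∧
    (p = 11 → 56 ≤ (blockClasses π p).card ∧ (blockClasses π p).card ≤ 60) := by
  have hcard : (Fintype.card ι : ℤ) ≠ 0 := by rw [hι]; norm_num
  exact hadamard668_signedAut_colClasses_window (isHadamard_transpose hH hcard) hι hmem κ π e d
    (isSignedAut_transpose haut) hκ hπ hne.symm

end Summit.Ventures.DiscreteObjects.Hadamard
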